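import Literature.Probability.RandomPlanarGeometry.SLEBubblesThm65Kappa
import Literature.Probability.RandomPlanarGeometry.HullRestrictionSLE
import Literature.Probability.RandomPlanarGeometry.SLEExistenceConverse
import Literature.Probability.RandomPlanarGeometry.CritPercSLESimplePathProofs
import Literature.Probability.RandomPlanarGeometry.JordanDomainProofs
import Literature.Probability.RandomPlanarGeometry.RestrictionHullsProofs
import Literature.Probability.RandomPlanarGeometry.RestrictionHullsRiemannProofs
import Summits.CriticalPhenomena.SAWScalingLimit.Theorems.SAWRenewalTightnessSubseqIdentificationSleRestrictionConsistency
import HarnessLib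

/-!
# Chordal SLE_κ, `0 < κ ≤ 8/3`, avoids a flat-window half-ball with positive probability (line `boundary-area-law`, RS5 helper)

Line `boundary-area-law` of the crux `SubseqIdentification` (stmt-CriticalPhenomena-0783, route
`SAWRenewalTightness`; primary decl `SAWParafermion.SubseqIdentification`), restriction reshape
(lead c4): second helper file for the SLE-side stub RS5 `stub_sleRestrictionRigidity` (for
`0 < κ ≤ 4`, `κ ≠ 8/3` the restriction identity `μ'(T) · μ(N_r) = μ(T ∩ N_r)`,
`N_r = {r ≤ dist(x₀, trace)}`, between the chordal SLE_κ laws of a flat-window Dobrushin domain `D`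
and of the carved domain `D' = D ∖ B̄(x₀, r)` FAILS).

POSITIVITY OF AVOIDANCE. The identity is vacuous (hence cannot fail) if `μ(N_r) = 0`; this file
proves `μ(N_r) > 0` for the chordal SLE_κ law `μ` of `D`, **for every `0 < κ ≤ 8/3`**
(`sleAvoidance_pos`) — the range in which the line consumes RS5 (S6⁺ gives `κ ≤ 8/3`). The proof
is [LSW] Theorem 6.5 in the tree's proved form `thm65_printed`: for `0 < κ ≤ 8/3` and a hull
`A ∈ 𝒬*` with restriction data `(Φ_A, Φ_A'(0))`,
`E[1{γ ∩ A = ∅} · exp(−λ ∫₀^∞ m(A_t − W_t) dt)] = Φ_A'(0)^α` (`α = (6 − κ)/(2κ)`,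
`λ = (8 − 3κ)(6 − κ)/(2κ) ≥ 0`), whence `P[γ ∩ A = ∅] ≥ Φ_A'(0)^α > 0` (`Φ_A'(0) > 0`,
`IsStarHull.exists_hasRestrictionDeriv_holds`). Applied to the pulled-back hull
`A = cl(ℍ ∖ φ⁻¹ D')` of the hull subdomain `D'` (`IsStarHull.pullbackHull`; `D'` is a hull
subdomain by `isHullSubdomain_of_carved`) under the chordal uniformizing map `φ` describing `μ`:
on `{γ ∩ A = ∅}` the compactified image curve lies in `D' ∪ {a, b} ⊆ cl D'`
(`disjoint_range_pullbackHull_iff`, the trace being simple for `κ ≤ 4`,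
`ae_isSimpleTrace_sleTrace_of_hasSLETrace`), and `{Γ ⊆ cl D'} ⊆ N_r`
(`closure_diff_closedBall_subset`). The general statement, for every hull subdomain, is
`measure_rangeSubset_closure_pos_of_isSLELaw`.

What is NOT here: positivity for `8/3 < κ ≤ 4` (no Thm. 6.5 in the tree there: the compensated
martingale of [LSW] Prop. 5.3 is unbounded for `λ < 0`); see the RS5 audit.

References: G. F. Lawler, O. Schramm, W. Werner, *Conformal restriction: the chordal case*,
J. Amer. Math. Soc. 16 (2003), Thm. 6.5 (§6) and Prop. 5.3 (§5); S. Rohde, O. Schramm, *Basic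
properties of SLE*, Ann. of Math. 161 (2005), Thm. 6.1. No named fact is used.
-/

noncomputable section

open MeasureTheory Filter Topology Set Metric
open scoped NNReal ENNReal
open Literature.Probability.RandomPlanarGeometry
open Literature.Probability.Process (preWienerMeasure)
open UpperHalfPlane (upperHalfPlaneSet)

namespace Summit.CriticalPhenomena.SAWScalingLimit.Theorems.SubseqIdentification.BoundaryAreaLaw

/-- **Chordal SLE_κ, `0 < κ ≤ 8/3`, stays inside a hull subdomain with positive probability.** If
`μ` is the chordal SLE_κ law of `(D; a, b)` and `D'` is a hull subdomain of `D`, then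
`μ{Γ ⊆ cl D'} > 0`. From [LSW] Thm. 6.5 (`thm65_printed`) for the pulled-back hull
`A = cl(ℍ ∖ φ⁻¹ D') ∈ 𝒬*`: `P[γ ∩ A = ∅] ≥ Φ_A'(0)^α > 0`, and on `{γ ∩ A = ∅}` the image curve
lies in `cl D'`. [cite: LawlerSchrammWerner2003Restriction, Thm. 6.5 (§6)] -/
theorem measure_rangeSubset_closure_pos_of_isSLELaw {κ : ℝ≥0} (hκ0 : 0 < κ) (hκ : κ ≤ 8 / 3)
    {D D' : DobrushinDomain} {μ : Measure (CurveClass ℂ)} (hμ : IsSLELaw κ D μ)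
    (hD' : D.IsHullSubdomain D') :
    0 < μ (CurveClass.rangeSubset (closure D'.carrier)) := by
  have hκ4 : κ ≤ 4 := hκ.trans (by rw [div_le_iff₀ (by norm_num : (0 : ℝ≥0) < 3)]; norm_num)
  obtain ⟨Γ, hΓ, rfl⟩ := hμ
  have hgen : HasSLETrace κ := hΓ.hasSLETrace
  obtain ⟨hΓm, φ, hφ, hae⟩ := hΓ
  -- the pulled-back hull and [LSW] Thm. 6.5
  have hA : IsStarHull (φ.pullbackHull D') :=
    IsStarHull.pullbackHull JordanDomain.isSimplyConnected_holds hφ hD'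
  obtain ⟨Φ, hΦ, -⟩ := IsStarHull.existsUnique_isRestrictionMap_holds hA
  obtain ⟨d, hd0, -, hd⟩ := IsStarHull.exists_hasRestrictionDeriv_holds hA hΦ
  have h65 := thm65_printed hκ0 hκ hA hΦ hd
  set E : Set (ℝ≥0 → ℝ) := {ω | Disjoint (range (sleTrace κ ω)) (φ.pullbackHull D')} with hE
  -- `Φ_A'(0)^α ≤ P[γ ∩ A = ∅]`
  have hle : ENNReal.ofReal (d ^ sleBubbleExponent κ) ≤ preWienerMeasure E := by
    rw [← h65]
    refine (lintegral_mono fun ω ↦ ?_).trans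
      ((lintegral_indicator_const_le E 1).trans_eq (one_mul _))
    exact Set.indicator_le_indicator (poissonAvoidance_le_one _)
  have hpos : 0 < preWienerMeasure E :=
    lt_of_lt_of_le (ENNReal.ofReal_pos.2 (Real.rpow_pos_of_pos hd0 _)) hle
  -- `{γ ∩ A = ∅} ⊆ {Γ ⊆ cl D'}` almost surely
  have hV : MeasurableSet (CurveClass.rangeSubset (closure D'.carrier)) :=
    CurveClass.measurableSet_rangeSubset isClosed_closure
  rw [Measure.map_apply_of_aemeasurable hΓm hV]
  refine hpos.trans_le (measure_mono_ae ?_)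
  filter_upwards [hae, ae_isSimpleTrace_sleTrace_of_hasSLETrace hgen hκ4] with ω ⟨_, c, hΓω, hc⟩
    hsimple hω
  change Γ ω ∈ CurveClass.rangeSubset (closure D'.carrier)
  rw [hΓω, CurveClass.mem_rangeSubset, CurveClass.range_mk]
  exact subset_closure_of_subset_carrier_union
    ((disjoint_range_pullbackHull_iff hφ hD' (sleTrace_zero κ ω) hsimple.2 hc).1 hω)

/-- **RS5 positivity — chordal SLE_κ (`0 < κ ≤ 8/3`) of a Dobrushin domain stays at distance `≥ r`
from `x₀` with positive probability, whenever the carved set `D ∖ B̄(x₀, r)` is the carrier of a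
Dobrushin domain `D'` with the same marked points and `r < ρ₀ ≤ dist(x₀, a), dist(x₀, b)`.**
`μ{r ≤ dist(x₀, trace)} ≥ μ{Γ ⊆ cl D'} > 0` (`measure_rangeSubset_closure_pos_of_isSLELaw` for the
hull subdomain `D'`, `isHullSubdomain_of_carved`, and `cl D' ⊆ cl D ∖ B(x₀, r)`). In particular the
restriction identity of `stub_sleRestrictionRigidity` is never vacuous in this range.
[cite: LawlerSchrammWerner2003Restriction, Thm. 6.5 (§6)] -/
theorem sleAvoidance_pos :
    ∀ (κ : ℝ≥0), 0 < κ → κ ≤ 8 / 3 →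
      ∀ (D D' : DobrushinDomain) (μ : Measure (CurveClass ℂ)) (x₀ : ℂ) (ρ₀ r : ℝ),
        r < ρ₀ → ρ₀ ≤ dist x₀ (D.pt 0) → ρ₀ ≤ dist x₀ (D.pt 1) →
        D'.carrier = D.carrier \ Metric.closedBall x₀ r → D'.pt 0 = D.pt 0 → D'.pt 1 = D.pt 1 →
        IsSLELaw κ D μ → 0 < μ {c | r ≤ Metric.infDist x₀ c.range} := by
  intro κ hκ0 hκ D D' μ x₀ ρ₀ r hrρ ha hb hD' h0 h1 hμ
  have hsub : D.IsHullSubdomain D' := isHullSubdomain_of_carved hrρ ha hb hD' h0 h1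
  refine (measure_rangeSubset_closure_pos_of_isSLELaw hκ0 hκ hμ hsub).trans_le (measure_mono ?_)
  intro c hc
  rw [CurveClass.mem_rangeSubset, hD'] at hc
  have h' := hc.trans (closure_diff_closedBall_subset _ _ _)
  exact (le_infDist c.range_nonempty).2 fun z hz ↦ by
    have h'' := (h' hz).2
    rw [mem_ball, not_lt, dist_comm] at h''
    exact h''

end Summit.CriticalPhenomena.SAWScalingLimit.Theorems.SubseqIdentification.BoundaryAreaLaw

end
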